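import Literature.AlgebraicGeometry.Resolution.GeneralizedStabilityRankOne
import Literature.AlgebraicGeometry.Resolution.Henselization
import HarnessLib

/-!
# Henselized rational function fields with a value-transcendental generator (Kuhlmann 2010, §2.3, §2.5, §5)

Topic: `Literature/AlgebraicGeometry/Resolution` (valued function fields). Sixth layer of the
decomposition of the named fact `Kuhlmann2010Stability` (`ValuationDefect.lean`) = F.-V. Kuhlmann,
*Elimination of ramification I: The generalized stability theorem*, Trans. AMS 362 (2010)
5697–5727 = arXiv:1003.5678, **Thm. 1.1**, along the printed proof (§5). After the reductions
(R1) ⇐ (R2) ⇐ (R3) ⇐ (R4) (`GeneralizedStabilityRational.lean`, `…TrdegOne.lean`,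
`…FiniteRank.lean`, `…RankOne.lean`) the theorem over a trivially valued ground field rests on
`Kuhlmann2010StabilityRankOneValueTranscendental` (and its residue-transcendental twin): statement
(R4) of §5 for a valued rational function field `F = K(t)` of rank one over an algebraically
closed `K` whose generator `t` is value-transcendental. Its printed proof (pp. 18–20 of the arXiv
version) runs:

> To complete our proof, we show that (R4) is true. Let `(F|K,v)` satisfy the conditions of
> (R4). Then there is a valuation-transcendental element `x ∈ F` and `F|K(x)` is finite. By
> Corollary 2.16 it suffices to prove (R4) under the additional assumption that `F|K` is rational
> with a valuation-transcendental generator. In view of Theorem 2.14, we can replace `(F,v)` by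
> its henselization. … Given an arbitrary finite extension `(E|F,v)`, we have to show that it is
> defectless. [ramification theory: `E.F^r|F^r` is a tower of normal extensions of degree `p`;
> Lemma 2.27; Prop. 2.18; Cor. 4.2; Prop. 3.1] … We have proved:
> *Henselized inertially generated function fields of rank 1 and of transcendence degree 1 with a
> valuation-transcendental generator over an algebraically closed ground field do not admit proper
> immediate algebraic extensions.*
> We use this fact to prove: **Lemma 5.5.** Every henselized function field `(F,v)` of rank 1 and
> of transcendence degree 1 without transcendence defect over an algebraically closed ground field
> `K` is a henselized inertially generated function field with a valuation-transcendental
> generator. *Proof.* Case I) Suppose `F` contains a value-transcendental element `x`. … This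
> yields `F = K(x')^h`. …
> The proof that `E.N|N` is defectless now proceeds by induction on the number of extensions
> appearing in the tower … by Lemma 2.13, `(E|N,v)` is defectless.

with (§2.5, p. 9) "a henselized function field `(F|K,v)` will be called henselized rational with
generator `x` if `F = K(x)^h`", (§2.3, (9)) "Assume that `(L|K,v)` is a finite extension and the
extension of `v` from `K` to `L` is unique. Then the Lemma of Ostrowski says that
`[L:K] = (vL:vK)·[Lv:Kv]·p^ν` with `ν ≥ 0` where `p` is the characteristic exponent of `Kv`",
and (§2.1) "[`(K,v)`] has rank 1 (i.e., its only convex subgroups are `{0}` and `vK`) if and only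
if `vK` is archimedean".

This file vendors, in the ambient rendering of `ValuedFunctionFields.lean` / `Henselization.lean`
(one algebraically closed valued field `(Ω, V)`, subfields `K ≤ F ≤ Ω` valued by `V ∩ F`, the
henselization `henselization V F ⊆ Ω`), the vocabulary of this last step and the three printed
results on which an assembly of `Kuhlmann2010StabilityRankOneValueTranscendental` at the level
of FINITE Galois theory rests (`GeneralizedStabilityRankOneVTProofs.lean`, in preparation: for
`F' = K(x')^h` and `E|F'` finite one argues by induction on `[E : F']` through a `p`-Sylow
subgroup and a central subgroup of order `p` of the Galois group, Ostrowski's lemma disposing of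
the steps of degree prime to `p`, the italicized statement of the steps of degree `p`, and
Lemma 5.5 keeping every intermediate field of the form `K(x'')^h`):

## Content

* `IsValueTranscendentalOver V K x` — "`x` is value-transcendental over `K`, i.e. its value `vx`
  is rationally independent over `vK`" (§2.5): `n·vx ∉ vK` for `n ≥ 1`. DEFINITION, with
  `IsValueTranscendentalOver.ne_zero`, `.valuation_ne_one`, `.anti` (smaller ground fields).
* `IsRankOneValued V F` — "`(F, v)` has rank 1", rendered through the source's own equivalence
  "if and only if `vF` is archimedean" (and non-trivial): some element of `F` has value `> 1`,
  and for `a, b ∈ F` with `v(a) > 1` some power `v(a)^n` exceeds `v(b)`. DEFINITION, with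
  `IsRankOneValued.of_le` (a subfield containing an element of value `≠ 1` is again of rank one).
* `henselizedAdjoin V K x = K(x)^h` — the henselized rational function field with generator `x`
  (§2.5). DEFINITION (an `abbrev` for `henselization V K(x)`), with `subset_henselizedAdjoin`,
  `mem_henselizedAdjoin_self`.
* `Kuhlmann2010OstrowskiLemma` — NAMED FACT, §2.3 (9): the Lemma of Ostrowski.
* `Kuhlmann2010HenselizedRationalImmediateExt` — NAMED FACT, the italicized statement of §5
  (p. 19) for henselized RATIONAL function fields with a VALUE-transcendental generator (weaker
  than print): `K(x)^h` of rank one, `x` value-transcendental over the algebraically closed `K`,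
  admits no proper immediate algebraic extension inside `Ω`.
* `Kuhlmann2010Lemma55ValueTranscendental` — NAMED FACT, Lemma 5.5 in Case I of its proof
  (with Lemma 2.26): a henselized function field `F₁^h` of rank one over an algebraically closed
  `K`, `F₁` finite over `K(x)` for a value-transcendental `x ∈ F₁`, is `K(x')^h` for a
  value-transcendental `x' ∈ F₁^h`.

## Sources

* F.-V. Kuhlmann, *Elimination of ramification I: The generalized stability theorem*, Trans.
  Amer. Math. Soc. 362 (2010) 5697–5727 = arXiv:1003.5678: §2.1 (rank, Lemma 2.1, Lemma 2.5),
  §2.3 ((9): Lemma of Ostrowski; Lemma 2.13; Thm. 2.14), §2.5 (henselized function fields,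
  value-transcendental generators, Lemmas 2.26–2.27), §5 (proof of (R4), pp. 18–20; Lemma 5.5).
  The source cites [En] = O. Endler, *Valuation theory* (1972) and [R] = P. Ribenboim, *Théorie
  des valuations* (1968) for Ostrowski's lemma.

## Rendering notes

* Value-transcendence over a SUBFIELD `K ≤ Ω` matches the typed hypothesis of
  `Kuhlmann2010StabilityRankOneValueTranscendental` (`∀ n ≥ 1, ∀ c : K, v(t)^n ≠ v(c)`); `c = 0`
  is allowed, so `x ≠ 0` is part of the notion (`IsValueTranscendentalOver.ne_zero`).
* Rank one. `GeneralizedStabilityRankOne.lean` renders "rank 1" of a typed `(F, F°)` by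
  overrings (`F° ≠ F`, the only overrings are `F°`, `F`); `nonempty_rankOne_of_overrings`
  (`CompositeValuations.lean`) turns this into archimedeanity of the value group, which is the
  form that passes to subfields and to algebraic extensions inside `Ω` and is used here.
* Ostrowski's lemma is typed (any finite `L/K`, any valuation ring `O'` of `L` which is the ONLY
  one over `O' ∩ K`); `p` is `ringExpChar` of the residue field `Kv` of `O' ∩ K`.
* In `Kuhlmann2010Lemma55ValueTranscendental` the hypothesis "valued function field of
  transcendence degree 1 without transcendence defect, containing a value-transcendental element"
  is rendered as: `F₁|K` finitely generated and algebraic over `K(x)` for some value-transcendental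
  `x ∈ F₁` (then `trdeg F₁|K = 1 = rr vF₁/vK`, Lemma 2.5 and Cor. 2.6); the value-transcendental
  element is taken in `F₁` rather than in `F₁^h` (no loss: `F₁^h|F₁` is immediate, Lemma 2.2).
-/

noncomputable section

open IsLocalRing

namespace Literature.AlgebraicGeometry.Resolution

universe u

/-! ### Value-transcendental elements, rank one, `K(x)^h` -/

section Defs

variable {Ω : Type u} [Field Ω] (V : ValuationSubring Ω)

/-- **`x` is value-transcendental over `K`** (Kuhlmann 2010, §2.5: "a value-transcendental element
`x ∈ F`, i.e., its value `vx` is rationally independent over `vK`"; §1.2: "the values `vxᵢ` … are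
rationally independent values in `vF` modulo `vK`"), for a subfield `K` of the valued field
`(Ω, V)`: no positive power of `v(x)` is the value of an element of `K` (`n·vx ∉ vK` for `n ≥ 1`,
additively). [cite: Kuhlmann2010, Section 2.5] -/
def IsValueTranscendentalOver (K : Subfield Ω) (x : Ω) : Prop :=
  ∀ n : ℕ, 0 < n → ∀ c ∈ K, V.valuation x ^ n ≠ V.valuation c

variable {V}

/-- A value-transcendental element is non-zero (`v(0) = v(0)^1`). [folklore] -/
theorem IsValueTranscendentalOver.ne_zero {K : Subfield Ω} {x : Ω}
    (hx : IsValueTranscendentalOver V K x) : x ≠ 0 := by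
  rintro rfl
  exact hx 1 one_pos 0 K.zero_mem (by rw [pow_one])

/-- A value-transcendental element has value `≠ 1 = v(1)`. [folklore] -/
theorem IsValueTranscendentalOver.valuation_ne_one {K : Subfield Ω} {x : Ω}
    (hx : IsValueTranscendentalOver V K x) : V.valuation x ≠ 1 := fun h =>
  hx 1 one_pos 1 K.one_mem (by rw [pow_one, h, map_one])

/-- Value-transcendence over `K` implies value-transcendence over every smaller field `K' ≤ K`.
[folklore] -/
theorem IsValueTranscendentalOver.anti {K K' : Subfield Ω} (h : K' ≤ K) {x : Ω}
    (hx : IsValueTranscendentalOver V K x) : IsValueTranscendentalOver V K' x :=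
  fun n hn c hc => hx n hn c (h hc)

/-- Either `v(x) > 1` or `v(x⁻¹) > 1` for a value-transcendental `x`. [folklore] -/
theorem IsValueTranscendentalOver.one_lt_or_one_lt_inv {K : Subfield Ω} {x : Ω}
    (hx : IsValueTranscendentalOver V K x) : 1 < V.valuation x ∨ 1 < V.valuation x⁻¹ := by
  rcases lt_or_gt_of_ne hx.valuation_ne_one with h | h
  · right
    rw [map_inv₀]
    exact one_lt_inv_iff₀.mpr ⟨(Valuation.pos_iff _).mpr hx.ne_zero, h⟩
  · exact Or.inl h

variable (V)

/-- **Rank one** for a subfield `F` of the valued field `(Ω, V)` (Kuhlmann 2010, §2.1: "The rank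
of a valued field `(K,v)` is the order type of the chain of non-trivial convex subgroups of its
value group `vK`. It has rank 1 (i.e., its only convex subgroups are `{0}` and `vK`) if and only
if `vK` is archimedean"), rendered by that equivalence: the value group `v(F^×)` is non-trivial
— some element of `F` has value `> 1` — and archimedean — for `a, b ∈ F` with `v(a) > 1` some
power `v(a)^n` is `≥ v(b)`. [cite: Kuhlmann2010, Section 2.1] -/
def IsRankOneValued (F : Subfield Ω) : Prop :=
  (∃ a ∈ F, 1 < V.valuation a) ∧
    ∀ a ∈ F, ∀ b ∈ F, 1 < V.valuation a → ∃ n : ℕ, V.valuation b ≤ V.valuation a ^ n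

variable {V}

/-- **Rank one passes to subfields with a non-trivial value**: if `(F, v)` has rank one,
`F' ≤ F`, and some element of `F'` has value `> 1`, then `(F', v)` has rank one. [folklore] -/
theorem IsRankOneValued.of_le {F F' : Subfield Ω} (h : F' ≤ F) (hF : IsRankOneValued V F)
    (hnt : ∃ a ∈ F', 1 < V.valuation a) : IsRankOneValued V F' :=
  ⟨hnt, fun a ha b hb h1 => hF.2 a (h ha) b (h hb) h1⟩

/-- A subfield of a rank-one `F` containing a value-transcendental element (over any `K`) has
rank one. [folklore] -/
theorem IsRankOneValued.of_le_of_isValueTranscendentalOver {F F' K : Subfield Ω} (h : F' ≤ F)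
    (hF : IsRankOneValued V F) {x : Ω} (hx : IsValueTranscendentalOver V K x) (hxF' : x ∈ F') :
    IsRankOneValued V F' := by
  refine hF.of_le h ?_
  rcases hx.one_lt_or_one_lt_inv with h1 | h1
  · exact ⟨x, hxF', h1⟩
  · exact ⟨x⁻¹, F'.inv_mem hxF', h1⟩

variable (V)

/-- **The henselized rational function field `K(x)^h`** with generator `x` (Kuhlmann 2010, §2.5:
"a henselized function field `(F|K,v)` will be called henselized rational with generator `x` if
`F = K(x)^h`"): the henselization inside `(Ω, V)` (`henselization`, `Henselization.lean`) of the
subfield `K(x)`. [cite: Kuhlmann2010, Section 2.5] -/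
abbrev henselizedAdjoin (K : Subfield Ω) (x : Ω) : Subfield Ω :=
  henselization V (IntermediateField.adjoin K ({x} : Set Ω)).toSubfield

/-- `K(x) ≤ K(x)^h`. [folklore] -/
theorem adjoin_le_henselizedAdjoin (K : Subfield Ω) (x : Ω) :
    (IntermediateField.adjoin K ({x} : Set Ω)).toSubfield ≤ henselizedAdjoin V K x :=
  le_henselization V _

/-- `K ≤ K(x)^h`. [folklore] -/
theorem le_henselizedAdjoin (K : Subfield Ω) (x : Ω) : K ≤ henselizedAdjoin V K x := by
  intro c hc
  refine adjoin_le_henselizedAdjoin V K x ?_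
  exact (IntermediateField.adjoin K ({x} : Set Ω)).algebraMap_mem ⟨c, hc⟩

/-- `x ∈ K(x)^h`. [folklore] -/
theorem mem_henselizedAdjoin_self (K : Subfield Ω) (x : Ω) : x ∈ henselizedAdjoin V K x :=
  adjoin_le_henselizedAdjoin V K x
    (IntermediateField.subset_adjoin K ({x} : Set Ω) (Set.mem_singleton x))

end Defs

/-! ### Named facts: Ostrowski's lemma, the italicized statement of §5, Lemma 5.5 (Case I) -/

/-- NAMED FACT — **the Lemma of Ostrowski** (Kuhlmann 2010, §2.3, (9): "Assume that `(L|K,v)` is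
a finite extension and the extension of `v` from `K` to `L` is unique. Then the Lemma of
Ostrowski says that `[L:K] = (vL:vK)·[Lv:Kv]·p^ν` with `ν ≥ 0` where `p` is the characteristic
exponent of `Kv`, that is, `p = char Kv` if this is positive, and `p = 1` otherwise (cf. [En],
[R])"). Rendering (as in `ValuationDefect.lean`): `L/K` finite, `O' = L°` a valuation ring of
`L` which is the ONLY valuation ring of `L` over `K° = O' ∩ K`; then
`[L : K] = e(O'/K) · f(O'/K) · p^ν` for some `ν`, with `e = ramificationIndex`,
`f = inertiaDegree` and `p = ringExpChar (Kv)`. Its classical proof ([En] §20, via the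
henselization and tame ramification theory) is not available in Mathlib. Users take
`(h : Kuhlmann2010OstrowskiLemma)`. [cite: Kuhlmann2010, Section 2.3, (9)] -/
def Kuhlmann2010OstrowskiLemma : Prop :=
  ∀ (K L : Type u) [Field K] [Field L] [Algebra K L], FiniteDimensional K L →
    ∀ O' : ValuationSubring L,
      (∀ O'' : ValuationSubring L,
        O''.comap (algebraMap K L) = O'.comap (algebraMap K L) → O'' = O') →
      ∃ ν : ℕ, Module.finrank K L =
        ramificationIndex K O' * inertiaDegree K O' *
          ringExpChar (ResidueField (O'.comap (algebraMap K L))) ^ ν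

/-- NAMED FACT — **henselized rational function fields of rank one with a value-transcendental
generator over an algebraically closed field admit no proper immediate algebraic extensions**
(Kuhlmann 2010, §5, proof of Thm. 1.1, the italicized statement on p. 19 of arXiv:1003.5678:
"*Henselized inertially generated function fields of rank 1 and of transcendence degree 1 with a
valuation-transcendental generator over an algebraically closed ground field do not admit proper
immediate algebraic extensions*"; §2.5: henselized rational `= K(x)^h` is the case of a trivial
inertial extension, and a value-transcendental generator is a valuation-transcendental one).
Vendored for henselized RATIONAL function fields with a VALUE-transcendental generator (weaker
than print). Statement, inside an algebraically closed valued field `(Ω, V)`: `K ≤ Ω`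
algebraically closed (valued by `V ∩ K`), `x` value-transcendental over `K`,
`F = K(x)^h = henselizedAdjoin V K x` of rank one (`IsRankOneValued`); if `F ≤ E ≤ Ω` with `E|F`
algebraic and immediate (`IsImmediateOver`: `vE = vF`, `Ev = Fv`), then `E = F`. Its printed
proof (pp. 18–19: the ramification group is a `p`-group, towers of normal extensions of degree
`p` inside `E.F^r|F^r`, Lemma 2.27, Prop. 2.18, Cor. 4.2 = the Artin–Schreier and Kummer normal
forms of §4.1, Prop. 3.1) is the heart of the paper and is not available in Mathlib. Users take
`(h : Kuhlmann2010HenselizedRationalImmediateExt)`.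
[cite: Kuhlmann2010, Section 5, proof of Thm. 1.1 (p. 19)] -/
def Kuhlmann2010HenselizedRationalImmediateExt : Prop :=
  ∀ (Ω : Type u) [Field Ω] [IsAlgClosed Ω] (V : ValuationSubring Ω) (K : Subfield Ω),
    IsAlgClosed K → ∀ x : Ω, IsValueTranscendentalOver V K x →
    IsRankOneValued V (henselizedAdjoin V K x) →
    ∀ E : Subfield Ω, henselizedAdjoin V K x ≤ E →
      (∀ a ∈ E, IsAlgebraic (henselizedAdjoin V K x) a) →
      IsImmediateOver V (henselizedAdjoin V K x) E → E = henselizedAdjoin V K x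

/-- NAMED FACT — **Kuhlmann 2010, Lemma 5.5 (Case I of its proof, with Lemma 2.26)**: "Every
henselized function field `(F,v)` of rank 1 and of transcendence degree 1 without transcendence
defect over an algebraically closed ground field `K` is a henselized inertially generated function
field with a valuation-transcendental generator. *Proof.* Case I) Suppose `F` contains a
value-transcendental element `x`. … `vF = vK ⊕ ℤvx' = vK(x')` … the henselian field `F` contains
the henselization `K(x')^h`, and … `F|K(x')^h` is an immediate extension. But … `K(x')^h` … does
not admit any proper immediate algebraic extension. This yields `F = K(x')^h`" (Lemma 2.26:
"Every henselized inertially generated function field of transcendence degree 1 with a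
value-transcendental generator over an algebraically closed field is a henselized rational function
field"; §2.5: "Such a henselization [of a valued function field] will be called a henselized
function field"). Statement, inside an algebraically closed valued field `(Ω, V)`: `K ≤ F₁ ≤ Ω`
with `K` algebraically closed, `F₁|K` finitely generated and algebraic over `K(x)` for some
`x ∈ F₁` value-transcendental over `K` (a valued function field of transcendence degree
`1 = rr vF₁/vK` without transcendence defect, Lemma 2.5 / Cor. 2.6, in Case I), and
`F = F₁^h = henselization V F₁` of rank one; then `F = K(x')^h` for some `x' ∈ F`
value-transcendental over `K`. The printed proof rests on the italicized statement of §5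
(`Kuhlmann2010HenselizedRationalImmediateExt`). Users take
`(h : Kuhlmann2010Lemma55ValueTranscendental)`. [cite: Kuhlmann2010, Lemma 5.5 and Lemma 2.26] -/
def Kuhlmann2010Lemma55ValueTranscendental : Prop :=
  ∀ (Ω : Type u) [Field Ω] [IsAlgClosed Ω] (V : ValuationSubring Ω) (K F₁ : Subfield Ω),
    IsAlgClosed K → K ≤ F₁ → FGOver K F₁ →
    ∀ x ∈ F₁, IsValueTranscendentalOver V K x →
    (∀ a ∈ F₁, IsAlgebraic (IntermediateField.adjoin K ({x} : Set Ω)) a) →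
    IsRankOneValued V (henselization V F₁) →
    ∃ x' ∈ henselization V F₁, IsValueTranscendentalOver V K x' ∧
      henselization V F₁ = henselizedAdjoin V K x'

end Literature.AlgebraicGeometry.Resolution
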